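import Summits.BirchSwinnertonDyer.Rank1Residual.GaloisImage.KatoKuriharaDictionaryThree
import Literature.NumberTheory.GaloisCohomology.FiniteSingularComparison
import HarnessLib

/-!
# DICT3 @ 3 in UNIVERSAL-CLOSURE form — ONE typed PORT hypothesis per record
# (cell `b2b-bsdres`, team n1011, ROUTE-1 R1-45 (b) = planner r1's text; row T-R1-45 FILE C; seat p18)

HONEST FRAMING (run/shared/lean/b2b/bsd-rank1-residual/, verbatim in every file): the goal of the
cell is to DELETE the COMBINATION-SHAPED residual classes of the Birch–Swinnerton-Dyer formula for
ALL analytic-rank `≤ 1` elliptic curves over `ℚ` — "full BSD formula for every rank `≤ 1` curve in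
class `C`" assembled STRICTLY from published theorems — so that the rank-`≤ 1` remainder becomes
exactly the CONSTRUCTION-SHAPED classes, which are TYPED (missing-input `Prop`s), NOT attempted.
This is not "finishing BSD". Team n1011 (N10/N11, the additive block `X4 ∧ p = 3`): research
route; no claim beyond the stated classes; the label X4 and the mark of RESIDUAL-MAP §I N11 are
UNCHANGED by this file; nothing is booked.  TWO definitions — a datum-shape predicate and the PORT
(a typed MISSING-INPUT predicate, the universal closure of n1011-p09's `KatoKuriharaDictionaryThreeAt₂`
(p263491); FLAG `K22-Thm3.13-PORT@3`; NOT in print at `3`, to be ASSUMED by its consumer, never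
`_holds`; ledger rider R-a: ONE debt line with DICT3 / DICT3₁ / DICT3₂, not a new one) — and the
unpacking lemmas; no named fact is minted; nothing is asserted.

## What and why

The END THEOREM of sub-route (a′) in Kim's ℕ-currency
(`Assembly.padicValRat_le_of_kolyvaginProduct_of_card_torsion_le`, p278772 over p276707 / p271924)
carries the two-level dictionary as the binder
`hdict : ∀ k′, k ≤ k′ → KatoKuriharaDictionaryThreeAt₂ W t k k′ D (D′ k′) (red k′) v₃`
for THE shallow datum `D` and THE deep data `D′ k′` of the record.  Planner r1 (ROUTE-1 §27.6
R1-45 (b)): records should carry ONE port hypothesis in universal-closure form, quantified over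
all depths and all data INSIDE THE RIGHT CLASS, "so the (B6)/Q24 vacuity guard is structural: the
port is only ever instantiated on data inside the deep class; on `t = 0` rows `𝒫_{k+1+t}` = the
pinned class and nothing changes".  This file types exactly that:

* `KolyvaginDatum.IsCanonicalTauDatumThreeAt W m j D` — the SHAPE GUARD on a datum `D` for
  `E[3^{j+1}]`: cyclotomic transverse conditions, THE canonical finite–singular comparison maps
  (for some choice `η` of generators), and primes inside a Sakamoto `τ`-class THROUGH `E[3^{m+1}]`
  off a set containing the bad places and the places above `3` (`τ ∈ Gal(ℚ̄/ℚ(μ_{3^{m+1}}))` with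
  (H.2) on `E[3^{m+1}]`).  In Kim's notation: `𝒫(D) ⊆ 𝒫_{m+1}` (ROUTE-1 §25.4 convention lemma:
  MR/Kim's `𝒫_k` = Sakamoto's `τ`-class of the tree); `m = j` is the PINNED class, `m = j + t`
  the DEEP class of (B6).  Every datum constructor of the tree outputs this shape
  (`FSComp.exists_eta_kolyvaginDatum_hasCanonicalComparison_frobeniusClassPrimes`, p04;
  `S24Deep.exists_eta_kolyvaginDatum_torsion_pow_mul_deep`, p15).
* `KatoKuriharaPortThreeAt W t v₃` — THE PORT: for all depths `k ≤ k′`, all data `D` (depth `k`,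
  guard at `m = k + t`) and `D′` (depth `k′`, guard at `m = k′ + t`), and every reduction map `red`
  (pinned to `x ↦ 3^{k′−k} x` inside DICT3₂): `KatoKuriharaDictionaryThreeAt₂ W t k k′ D D′ red v₃`.
* `KatoKuriharaPortThreeAt.dictionary₂` — unpacking to the END theorem's `hdict` binder;
  `isCanonicalTauDatumThreeAt_of_primes_eq` (pinned data) / `…_of_le` (class descent `m′ ↦ m`,
  not needed by the port) / `IsCanonicalTauDatumThreeAt.of_primes_subset` (sub-data).

What is NOT here: any proof or instance of the port (`_holds`); anything about `t`, `c₃`, the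
tower or the certificate — those stay the consumer's binders.

References: [Kim2022StructureSelmer] Thm. 3.13, §2.2.2, §3.3–§3.4.1 (arXiv pp. 12, 17–18);
[MazurRubin2004] Def. 3.1.3, Thm. 3.2.4, App. A (33); [Kato2004Asterisque] Thm. 12.5 (1);
[Sakamoto2024] §2 (the set `𝒫`, (H.2)), Def. 4.1; cells/n1011/ROUTE-1.md §24.2 (B6), §25.4, §27.6
R1-45 (b), §29.5.
-/

noncomputable section

open scoped Classical NumberField ContRepresentation
open Field NumberField IsDedekindDomain WeierstrassCurve
  Literature.NumberTheory.EllipticCurves Literature.NumberTheory.EllipticCurves.ModularForms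
  Literature.NumberTheory.EllipticCurves.Rank1Residual
  Literature.NumberTheory.GaloisRepresentations
  Literature.NumberTheory.GaloisRepresentations.DiscreteGaloisModule Literature.NumberTheory.GaloisCohomology

namespace Summit.BirchSwinnertonDyer.Rank1Residual.GaloisImage

/-- **Shape guard: a canonical `τ`-datum for `E[3^{j+1}]` with primes in the class of depth `m`.**
`D.transverse` = the cyclotomic transverse conditions; `D.fs` = THE canonical finite–singular
comparison maps for some generators `η` (`D.HasCanonicalComparison (3^{j+1}) η`, which includes
`⟨η_𝔮⟩ = (ℤ/N𝔮)ˣ` at every `𝔮 ∈ 𝒫(D)`); and `𝒫(D) ⊆ frobeniusClassPrimes ρ_{E,3^{m+1}} S τ 3^{m+1}`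
for SOME `S` all of whose outside places are good and prime to `3` and SOME `τ ∈ Gal(ℚ̄/ℚ(μ_{3^{m+1}}))`
with (H.2) `E[3^{m+1}]/(τ − 1) ≃ ℤ/3^{m+1}` — i.e. `𝒫(D) ⊆ 𝒫_{m+1}` in Kim's notation (Sakamoto's
`τ`-class ⊆ Kim's `𝒫_{m+1}`; `m = j`: pinned, `m = j + t`: the deep class of (B6)).
[cite: Sakamoto2024, §2 (the set 𝒫 and (H.2), pp. 920–921) and Def. 4.1]
[cite: Kim2022StructureSelmer, §1.2.2 and §2.1.2] -/
def _root_.Literature.NumberTheory.GaloisCohomology.KolyvaginDatum.IsCanonicalTauDatumThreeAt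
    (W : WeierstrassCurve ℚ) [W.IsElliptic] (m j : ℕ)
    (D : KolyvaginDatum (W.torsionGaloisModule (((3 : ℕ) : ℤ) ^ j * ((3 : ℕ) : ℤ)))) : Prop :=
  D.transverse = cyclotomicTransverse (W.torsionGaloisModule (((3 : ℕ) : ℤ) ^ j * ((3 : ℕ) : ℤ))) ∧
  (∃ η : (q : HeightOneSpectrum (𝓞 ℚ)) → (ZMod (Ideal.absNorm q.asIdeal))ˣ,
    D.HasCanonicalComparison (3 ^ (j + 1)) η) ∧
  ∃ (S : Set (HeightOneSpectrum (𝓞 ℚ))) (τ : absoluteGaloisGroup ℚ),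
    (∀ v ∉ S, W.HasGoodReductionAt v ∧ ((3 : ℕ) : 𝓞 ℚ) ∉ v.asIdeal) ∧
    τ ∈ rootsOfUnityFixer ℚ (3 ^ (m + 1)) ∧
    Nonempty (cokerSubOne (W.torsionGaloisModule (((3 : ℕ) : ℤ) ^ m * ((3 : ℕ) : ℤ))) τ ≃+
      ZMod (3 ^ (m + 1))) ∧
    D.primes ⊆ frobeniusClassPrimes (W.torsionGaloisModule (((3 : ℕ) : ℤ) ^ m * ((3 : ℕ) : ℤ)))
      S τ (3 ^ (m + 1))

/-- **DICT3 @ 3 in UNIVERSAL-CLOSURE form — THE PORT (FLAG `K22-Thm3.13-PORT@3`; NOT in print at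
`3`; a missing-input predicate, to be ASSUMED by its consumer, never `_holds`; ledger rider R-a: the
SAME debt line as `KatoKuriharaDictionaryThreeAt` / `…OneAt` / `…At₂`).**  For `W/ℚ` globally
minimal, the `3`-torsion exponent `t` and a place `v₃`: for ALL depths `k, k′`, ALL canonical
`τ`-data `D` for `E[3^{k+1}]` with primes in the class of depth `k + t` and `D′` for `E[3^{k′+1}]`
with primes in the class of depth `k′ + t` ((B6): the DEEP classes; at `t = 0` the pinned ones), and
every reduction map `red` (pinned to `x ↦ 3^{k′−k}·x` inside), the two-level dictionary
`KatoKuriharaDictionaryThreeAt₂ W t k k′ D D′ red v₃` holds — Kato's derivative families at both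
depths with Kolyvagin-system corrections, the dual-exponential functionals, `Λ(loc κ_d) = u·3^t·δ̃_{n(d)}`,
and reduction compatibility on common levels (its own docstring; its antecedents `k ≤ k′`, `Addv W 3`,
`3 ∤ c₃`, surj(3), `#E(ℚ₃)[3] = 3^t`, `v₃ ∣ 3`, the parametrisation datum stay INSIDE it).
[cite: Kim2022StructureSelmer, Thm. 3.13 and §2.2.2, §3.3–§3.4.1 (arXiv pp. 12, 17–18)]
[cite: MazurRubin2004, Def. 3.1.3, Thm. 3.2.4 and App. A (33)] [cite: Kato2004Asterisque, Thm. 12.5 (1)] -/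
def KatoKuriharaPortThreeAt (W : WeierstrassCurve ℚ) [W.IsElliptic] [W.IsGloballyMinimal]
    (t : ℕ) (v₃ : HeightOneSpectrum (𝓞 ℚ)) : Prop :=
  ∀ (k k' : ℕ) (D : KolyvaginDatum (W.torsionGaloisModule (((3 : ℕ) : ℤ) ^ k * ((3 : ℕ) : ℤ))))
    (D' : KolyvaginDatum (W.torsionGaloisModule (((3 : ℕ) : ℤ) ^ k' * ((3 : ℕ) : ℤ))))
    (red : (W.torsionGaloisModule (((3 : ℕ) : ℤ) ^ k' * ((3 : ℕ) : ℤ))).toContRepresentation →ⁱL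
      (W.torsionGaloisModule (((3 : ℕ) : ℤ) ^ k * ((3 : ℕ) : ℤ))).toContRepresentation),
    D.IsCanonicalTauDatumThreeAt W (k + t) k → D'.IsCanonicalTauDatumThreeAt W (k' + t) k' →
      KatoKuriharaDictionaryThreeAt₂ W t k k' D D' red v₃

variable {W : WeierstrassCurve ℚ} [W.IsElliptic]

/-- **Unpacking the port to the END theorem's binder `hdict`**: for a guarded shallow datum `D` at
depth `k` and guarded deep data `D′ k′` at every depth, the port gives
`∀ k′, k ≤ k′ → KatoKuriharaDictionaryThreeAt₂ W t k k′ D (D′ k′) (red k′) v₃`.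
[cite: Kim2022StructureSelmer, Thm. 3.13] -/
theorem KatoKuriharaPortThreeAt.dictionary₂ [W.IsGloballyMinimal] {t : ℕ}
    {v₃ : HeightOneSpectrum (𝓞 ℚ)} (h : KatoKuriharaPortThreeAt W t v₃) {k : ℕ}
    {D : KolyvaginDatum (W.torsionGaloisModule (((3 : ℕ) : ℤ) ^ k * ((3 : ℕ) : ℤ)))}
    (hD : D.IsCanonicalTauDatumThreeAt W (k + t) k)
    {D' : ∀ k' : ℕ, KolyvaginDatum (W.torsionGaloisModule (((3 : ℕ) : ℤ) ^ k' * ((3 : ℕ) : ℤ)))}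
    (hD' : ∀ k', (D' k').IsCanonicalTauDatumThreeAt W (k' + t) k')
    (red : ∀ k' : ℕ, (W.torsionGaloisModule (((3 : ℕ) : ℤ) ^ k' * ((3 : ℕ) : ℤ))).toContRepresentation
      →ⁱL (W.torsionGaloisModule (((3 : ℕ) : ℤ) ^ k * ((3 : ℕ) : ℤ))).toContRepresentation) :
    ∀ k', k ≤ k' → KatoKuriharaDictionaryThreeAt₂ W t k k' D (D' k') (red k') v₃ :=
  fun k' _ => h k k' D (D' k') (red k') hD (hD' k')

/-- **A pinned canonical `τ`-datum passes the guard at its own depth** (`m = j = k`): the output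
shape of `FSComp.exists_eta_kolyvaginDatum_hasCanonicalComparison_frobeniusClassPrimes` with
`S ⊇ {bad} ∪ {v ∣ 3}`. [cite: Sakamoto2024, §2 and Def. 4.1] -/
theorem isCanonicalTauDatumThreeAt_of_primes_eq {k : ℕ}
    {D : KolyvaginDatum (W.torsionGaloisModule (((3 : ℕ) : ℤ) ^ k * ((3 : ℕ) : ℤ)))}
    {S : Set (HeightOneSpectrum (𝓞 ℚ))}
    (hS : ∀ v ∉ S, W.HasGoodReductionAt v ∧ ((3 : ℕ) : 𝓞 ℚ) ∉ v.asIdeal)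
    {τ : absoluteGaloisGroup ℚ} (hτμ : τ ∈ rootsOfUnityFixer ℚ (3 ^ (k + 1)))
    (hτq : Nonempty (cokerSubOne (W.torsionGaloisModule (((3 : ℕ) : ℤ) ^ k * ((3 : ℕ) : ℤ))) τ ≃+
      ZMod (3 ^ (k + 1))))
    (hP : D.primes = frobeniusClassPrimes (W.torsionGaloisModule (((3 : ℕ) : ℤ) ^ k * ((3 : ℕ) : ℤ)))
      S τ (3 ^ (k + 1)))
    (hT : D.transverse = cyclotomicTransverse (W.torsionGaloisModule (((3 : ℕ) : ℤ) ^ k * ((3 : ℕ) : ℤ))))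
    {η : (q : HeightOneSpectrum (𝓞 ℚ)) → (ZMod (Ideal.absNorm q.asIdeal))ˣ}
    (hD : D.HasCanonicalComparison (3 ^ (k + 1)) η) :
    D.IsCanonicalTauDatumThreeAt W k k :=
  ⟨hT, ⟨η, hD⟩, S, τ, hS, hτμ, hτq, hP.le⟩

/-- **A canonical `τ`-datum with primes in a DEEPER class passes the guard at that depth** (the
output shape of p15's deep constructor `S24Deep.exists_eta_kolyvaginDatum_torsion_pow_mul_deep`:
datum for `E[3^{k+1}]`, primes = the class through `E[3^{m+1}]`, `k ≤ m`).
[cite: Sakamoto2024, §2 and Def. 4.1] -/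
theorem isCanonicalTauDatumThreeAt_of_primes_eq_deep {k m : ℕ}
    {D : KolyvaginDatum (W.torsionGaloisModule (((3 : ℕ) : ℤ) ^ k * ((3 : ℕ) : ℤ)))}
    {S : Set (HeightOneSpectrum (𝓞 ℚ))}
    (hS : ∀ v ∉ S, W.HasGoodReductionAt v ∧ ((3 : ℕ) : 𝓞 ℚ) ∉ v.asIdeal)
    {τ : absoluteGaloisGroup ℚ} (hτμ : τ ∈ rootsOfUnityFixer ℚ (3 ^ (m + 1)))
    (hτq : Nonempty (cokerSubOne (W.torsionGaloisModule (((3 : ℕ) : ℤ) ^ m * ((3 : ℕ) : ℤ))) τ ≃+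
      ZMod (3 ^ (m + 1))))
    (hP : D.primes = frobeniusClassPrimes (W.torsionGaloisModule (((3 : ℕ) : ℤ) ^ m * ((3 : ℕ) : ℤ)))
      S τ (3 ^ (m + 1)))
    (hT : D.transverse = cyclotomicTransverse (W.torsionGaloisModule (((3 : ℕ) : ℤ) ^ k * ((3 : ℕ) : ℤ))))
    {η : (q : HeightOneSpectrum (𝓞 ℚ)) → (ZMod (Ideal.absNorm q.asIdeal))ˣ}
    (hD : D.HasCanonicalComparison (3 ^ (k + 1)) η) :
    D.IsCanonicalTauDatumThreeAt W m k :=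
  ⟨hT, ⟨η, hD⟩, S, τ, hS, hτμ, hτq, hP.le⟩

/-- **Sub-data inherit the prime guard**: if `𝒫(D′) ⊆ 𝒫(D)` for a guarded `D` (depth of class
`m`) and `D′` has the cyclotomic transverse conditions and canonical comparison maps, then `D′` is
guarded at depth `m` as well. [cite: Sakamoto2024, §2 and Def. 4.1] -/
theorem IsCanonicalTauDatumThreeAt.of_primes_subset {m j j' : ℕ}
    {D : KolyvaginDatum (W.torsionGaloisModule (((3 : ℕ) : ℤ) ^ j * ((3 : ℕ) : ℤ)))}
    (hD : D.IsCanonicalTauDatumThreeAt W m j)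
    {D' : KolyvaginDatum (W.torsionGaloisModule (((3 : ℕ) : ℤ) ^ j' * ((3 : ℕ) : ℤ)))}
    (hPP : D'.primes ⊆ D.primes)
    (hT : D'.transverse =
      cyclotomicTransverse (W.torsionGaloisModule (((3 : ℕ) : ℤ) ^ j' * ((3 : ℕ) : ℤ))))
    {η : (q : HeightOneSpectrum (𝓞 ℚ)) → (ZMod (Ideal.absNorm q.asIdeal))ˣ}
    (hD' : D'.HasCanonicalComparison (3 ^ (j' + 1)) η) :
    D'.IsCanonicalTauDatumThreeAt W m j' := by
  obtain ⟨-, -, S, τ, hS, hτμ, hτq, hP⟩ := hD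
  exact ⟨hT, ⟨η, hD'⟩, S, τ, hS, hτμ, hτq, hPP.trans hP⟩

end Summit.BirchSwinnertonDyer.Rank1Residual.GaloisImage

end
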